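import Literature.IUT.HodgeArakelov.MonoThetaProjectiveLimOneMonomials

/-!
# [IUTchII] Prop. 1.5 (i)′ is still a schema, II: the groups and structure maps of the lim¹ twin (toy)

S. Mochizuki, *Inter-universal Teichmüller theory II*, kurims manuscript (Dec. 2020), §1, Prop. 1.5 (i) p. 29
[claim: Mochizuki2012, status: disputed] (IUTchII §1 Prop 1.5 (i), kurims p.29); FACT-LIST row **F-0670** `Prop15_i'`.
abc-iut cell, block F, seat abc-iut-f-130 (gen 8).  Sequel of `MonoThetaProjectiveLimOneMonomials.lean`.

THIS FILE: the underlying groups of the JUNK model family — `R := ℤ^{(Mon)}` (multiplicatively, DISCRETE topology: a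
scoped instance on this toy type only), `E₀ := R × Ẑ` (the tree's `Ẑ = Literature.IUT.HodgeTheaters.ZHat`; it plays
`Π_Y = Π_X = G` and carries the interior cyclotome), `Π_M := E₀ × ℤ/M` (the factor `ℤ/M` is the exterior cyclotome
`Ker(Π_M ↠ Π_Y)`); the structure maps `Phom h d k := (mapDomain g_{d,k}) × id_Ẑ × (ℤ/M' ↠ ℤ/M)` with their
composition law; the LEVEL `v₂(M)` of an index, the gap `d` of an arrow `M ∣ M'`, the cocycle exponents
`c_d := (3^d − 1)/2` with `c_{d+d'} = c_d + 3^d c_{d'}`; the transitions `transOf a h := Phom h d (a·c_d)` of the system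
with twist parameter `a` (functorial for every `a`); and the cones `T̂_m ⊆ Π_M` with the KEY computation
`Phom h d k (T̂_m) = T̂_{g_{d,k}(m)}`.  JUNK/TOY by design; no side taken on [IUTchIII] Cor. 3.12; typed ≠ proved.
-/

noncomputable section

namespace Literature.IUT.HodgeArakelov

namespace LimOneToy

open Prop13Toy (Zh)

/-! ## The topological groups: `R := ℤ^{(Mon)}` (discrete), `E₀ := R × Ẑ`, `Π_M := E₀ × ℤ/M` -/

/-- `R := ℤ^{(Mon)}`, written multiplicatively. [claim: Mochizuki2012, status: disputed] (IUTchII §1 Prop 1.5 (i), kurims p.29) -/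
abbrev Rgrp : Type := Multiplicative (Mon →₀ ℤ)

/-- The DISCRETE topology on `R` (no topology is registered on finsupp groups); scoped to this namespace. [claim: Mochizuki2012, status: disputed] (IUTchII §1 Prop 1.5 (i), kurims p.29) -/
scoped instance instTopologicalSpaceRgrp : TopologicalSpace Rgrp := ⊥

/-- `R` is discrete. [claim: Mochizuki2012, status: disputed] (IUTchII §1 Prop 1.5 (i), kurims p.29) -/
scoped instance instDiscreteTopologyRgrp : DiscreteTopology Rgrp := ⟨rfl⟩

/-- `E₀ := R × Ẑ` (plays `Π_Y = Π_X = G` at every level, and the setting's `Π^tp`, `G_k`). [claim: Mochizuki2012, status: disputed] (IUTchII §1 Prop 1.5 (i), kurims p.29) -/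
abbrev E₀ : Type := Rgrp × Zh

/-- `Π_M := E₀ × ℤ/M`. [claim: Mochizuki2012, status: disputed] (IUTchII §1 Prop 1.5 (i), kurims p.29) -/
abbrev Car (M : ℕ+) : Type := E₀ × Multiplicative (ZMod M)

/-- The `R`-part of the structure maps: `mapDomain g_{d,k}`, multiplicatively. [claim: Mochizuki2012, status: disputed] (IUTchII §1 Prop 1.5 (i), kurims p.29) -/
def Rhom (d : ℕ) (k : ℤ) : Rgrp →* Rgrp :=
  AddMonoidHom.toMultiplicative (Finsupp.mapDomain.addMonoidHom (gmap d k))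

/-- `Rhom d k` is `mapDomain g_{d,k}` read multiplicatively. [claim: Mochizuki2012, status: disputed] (IUTchII §1 Prop 1.5 (i), kurims p.29) -/
theorem Rhom_apply (d : ℕ) (k : ℤ) (f : Mon →₀ ℤ) :
    Rhom d k (Multiplicative.ofAdd f) = Multiplicative.ofAdd (Finsupp.mapDomain (gmap d k) f) := rfl

/-- Composition law of the `R`-maps (from the cocycle law of the index maps). [claim: Mochizuki2012, status: disputed] (IUTchII §1 Prop 1.5 (i), kurims p.29) -/
theorem Rhom_comp (d d' : ℕ) (k k' : ℤ) : (Rhom d k).comp (Rhom d' k') = Rhom (d + d') (k + 3 ^ d * k') := by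
  rw [Rhom, Rhom, Rhom, ← gmap_comp, Finsupp.mapDomain.addMonoidHom_comp]
  rfl

/-- `Rhom 0 0 = id`. [claim: Mochizuki2012, status: disputed] (IUTchII §1 Prop 1.5 (i), kurims p.29) -/
theorem Rhom_zero_zero : Rhom 0 0 = MonoidHom.id Rgrp := by
  rw [Rhom, gmap_zero_zero, Finsupp.mapDomain.addMonoidHom_id]
  rfl

/-- `φ^d` is onto. [claim: Mochizuki2012, status: disputed] (IUTchII §1 Prop 1.5 (i), kurims p.29) -/
theorem φpow_surjective (d : ℕ) : Function.Surjective (φpow d) := by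
  induction d with
  | zero => intro z; exact ⟨z, rfl⟩
  | succ d ih =>
    intro z
    obtain ⟨z', rfl⟩ := φ_surjective z
    obtain ⟨z'', rfl⟩ := ih z'
    exact ⟨z'', rfl⟩

/-- `g_{d,k}` is onto. [claim: Mochizuki2012, status: disputed] (IUTchII §1 Prop 1.5 (i), kurims p.29) -/
theorem gmap_surjective (d : ℕ) (k : ℤ) : Function.Surjective (gmap d k) := by
  intro y
  obtain ⟨m, hm⟩ := φpow_surjective d (addX (-k) y)
  exact ⟨m, by rw [gmap, hm, addX_addX, neg_add_cancel, addX_zero, id]⟩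

/-- The `R`-maps are onto (so the model reductions will be). [claim: Mochizuki2012, status: disputed] (IUTchII §1 Prop 1.5 (i), kurims p.29) -/
theorem Rhom_surjective (d : ℕ) (k : ℤ) : Function.Surjective (Rhom d k) := by
  intro r
  obtain ⟨f, hf⟩ := Finsupp.mapDomain_surjective (gmap_surjective d k) (Multiplicative.toAdd r)
  exact ⟨Multiplicative.ofAdd f, by rw [Rhom_apply, hf]; rfl⟩

/-- The `E₀`-part: `Rhom × id`. [claim: Mochizuki2012, status: disputed] (IUTchII §1 Prop 1.5 (i), kurims p.29) -/
def Xhom (d : ℕ) (k : ℤ) : E₀ →* E₀ := (Rhom d k).prodMap (MonoidHom.id Zh)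

/-- The reduction `ℤ/M' → ℤ/M`, multiplicatively. [claim: Mochizuki2012, status: disputed] (IUTchII §1 Prop 1.5 (i), kurims p.29) -/
def castMul {M M' : ℕ+} (h : (M : ℕ) ∣ (M' : ℕ)) : Multiplicative (ZMod M') →* Multiplicative (ZMod M) :=
  AddMonoidHom.toMultiplicative (ZMod.castHom h (ZMod M)).toAddMonoidHom

/-- `ℤ/M' ↠ ℤ/M` is onto. [claim: Mochizuki2012, status: disputed] (IUTchII §1 Prop 1.5 (i), kurims p.29) -/
theorem castMul_surjective {M M' : ℕ+} (h : (M : ℕ) ∣ (M' : ℕ)) : Function.Surjective (castMul h) := by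
  intro z
  obtain ⟨w, hw⟩ := ZMod.castHom_surjective h (Multiplicative.toAdd z)
  exact ⟨Multiplicative.ofAdd w, by simpa [castMul] using congrArg Multiplicative.ofAdd hw⟩

/-- `ℤ/M → ℤ/M` is the identity. [claim: Mochizuki2012, status: disputed] (IUTchII §1 Prop 1.5 (i), kurims p.29) -/
theorem castMul_refl (M : ℕ+) : castMul (dvd_refl (M : ℕ)) = MonoidHom.id _ := by
  have h : ZMod.castHom (dvd_refl (M : ℕ)) (ZMod M) = RingHom.id _ := RingHom.ext_zmod _ _
  rw [castMul, h]
  rfl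

/-- `ℤ/M'' → ℤ/M' → ℤ/M` composes to `ℤ/M'' → ℤ/M`. [claim: Mochizuki2012, status: disputed] (IUTchII §1 Prop 1.5 (i), kurims p.29) -/
theorem castMul_comp {M M' M'' : ℕ+} (h : (M : ℕ) ∣ (M' : ℕ)) (h' : (M' : ℕ) ∣ (M'' : ℕ)) :
    (castMul h).comp (castMul h') = castMul (dvd_trans h h') := by
  have hc : (ZMod.castHom h (ZMod M)).comp (ZMod.castHom h' (ZMod M')) = ZMod.castHom (dvd_trans h h') (ZMod M) :=
    RingHom.ext_zmod _ _
  rw [castMul, castMul, castMul, ← hc]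
  rfl

/-- The structure maps `Π_{M'} → Π_M`: `(mapDomain g_{d,k}) × id_Ẑ × (ℤ/M' ↠ ℤ/M)`. [claim: Mochizuki2012, status: disputed] (IUTchII §1 Prop 1.5 (i), kurims p.29) -/
def Phom {M M' : ℕ+} (h : (M : ℕ) ∣ (M' : ℕ)) (d : ℕ) (k : ℤ) : Car M' →* Car M :=
  (Xhom d k).prodMap (castMul h)

/-- Components of `Phom h d k`. [claim: Mochizuki2012, status: disputed] (IUTchII §1 Prop 1.5 (i), kurims p.29) -/
theorem Phom_apply {M M' : ℕ+} (h : (M : ℕ) ∣ (M' : ℕ)) (d : ℕ) (k : ℤ) (y : Car M') :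
    Phom h d k y = ((Rhom d k y.1.1, y.1.2), castMul h y.2) := rfl

/-- `Phom h d k` is onto. [claim: Mochizuki2012, status: disputed] (IUTchII §1 Prop 1.5 (i), kurims p.29) -/
theorem Phom_surjective {M M' : ℕ+} (h : (M : ℕ) ∣ (M' : ℕ)) (d : ℕ) (k : ℤ) : Function.Surjective (Phom h d k) :=
  ((Rhom_surjective d k).prodMap Function.surjective_id).prodMap (castMul_surjective h)

/-- `Phom h d k` is continuous (`R`, `ℤ/M` discrete; identity on `Ẑ`). [claim: Mochizuki2012, status: disputed] (IUTchII §1 Prop 1.5 (i), kurims p.29) -/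
theorem continuous_Phom {M M' : ℕ+} (h : (M : ℕ) ∣ (M' : ℕ)) (d : ℕ) (k : ℤ) : Continuous (Phom h d k) :=
  ((continuous_of_discreteTopology (f := Rhom d k)).prodMap continuous_id).prodMap
    continuous_of_discreteTopology

/-- Composition law of the structure maps `Phom`. [claim: Mochizuki2012, status: disputed] (IUTchII §1 Prop 1.5 (i), kurims p.29) -/
theorem Phom_comp {M M' M'' : ℕ+} (h : (M : ℕ) ∣ (M' : ℕ)) (h' : (M' : ℕ) ∣ (M'' : ℕ)) (d d' : ℕ) (k k' : ℤ) :
    (Phom h d k).comp (Phom h' d' k') = Phom (dvd_trans h h') (d + d') (k + 3 ^ d * k') := by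
  refine MonoidHom.ext fun y => Prod.ext (Prod.ext ?_ rfl) ?_
  · show ((Rhom d k).comp (Rhom d' k')) y.1.1 = Rhom _ _ y.1.1
    rw [Rhom_comp]
  · show ((castMul h).comp (castMul h')) y.2 = castMul _ y.2
    rw [castMul_comp]

/-- `Phom (refl) 0 0 = id`. [claim: Mochizuki2012, status: disputed] (IUTchII §1 Prop 1.5 (i), kurims p.29) -/
theorem Phom_refl_zero_zero (M : ℕ+) (y : Car M) : Phom (dvd_refl (M : ℕ)) 0 0 y = y := by
  rw [Phom_apply, Rhom_zero_zero, castMul_refl]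
  rfl

/-! ## Levels and the cocycle exponents -/

/-- The level of `M`: its `2`-adic valuation. [claim: Mochizuki2012, status: disputed] (IUTchII §1 Prop 1.5 (i), kurims p.29) -/
def lvl (M : ℕ+) : ℕ := (M : ℕ).factorization 2

/-- The level is monotone along divisibility. [claim: Mochizuki2012, status: disputed] (IUTchII §1 Prop 1.5 (i), kurims p.29) -/
theorem lvl_mono {M M' : ℕ+} (h : (M : ℕ) ∣ (M' : ℕ)) : lvl M ≤ lvl M' :=
  (Nat.factorization_le_iff_dvd M.ne_zero M'.ne_zero).mpr h 2

/-- The gap `d := v₂(M') − v₂(M)` of an arrow `M ∣ M'`. [claim: Mochizuki2012, status: disputed] (IUTchII §1 Prop 1.5 (i), kurims p.29) -/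
def gap {M M' : ℕ+} (_h : (M : ℕ) ∣ (M' : ℕ)) : ℕ := lvl M' - lvl M

/-- The identity arrow has gap `0`. [claim: Mochizuki2012, status: disputed] (IUTchII §1 Prop 1.5 (i), kurims p.29) -/
theorem gap_refl (M : ℕ+) : gap (dvd_refl (M : ℕ)) = 0 := Nat.sub_self _

/-- Gaps add along composable arrows. [claim: Mochizuki2012, status: disputed] (IUTchII §1 Prop 1.5 (i), kurims p.29) -/
theorem gap_trans {M M' M'' : ℕ+} (h : (M : ℕ) ∣ (M' : ℕ)) (h' : (M' : ℕ) ∣ (M'' : ℕ)) :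
    gap (dvd_trans h h') = gap h + gap h' := by
  have := lvl_mono h; have := lvl_mono h'
  simp only [gap]; omega

/-- The cocycle exponent `c_d := (3^d − 1)/2`. [claim: Mochizuki2012, status: disputed] (IUTchII §1 Prop 1.5 (i), kurims p.29) -/
def cexp (d : ℕ) : ℕ := (3 ^ d - 1) / 2

/-- `2 c_d + 1 = 3^d`. [claim: Mochizuki2012, status: disputed] (IUTchII §1 Prop 1.5 (i), kurims p.29) -/
theorem two_mul_cexp_add_one (d : ℕ) : 2 * cexp d + 1 = 3 ^ d := by
  have h1 : 1 ≤ 3 ^ d := Nat.one_le_pow _ _ (by norm_num)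
  have h2 : 2 ∣ 3 ^ d - 1 := by
    have : Odd (3 ^ d) := Odd.pow (by decide)
    obtain ⟨r, hr⟩ := this
    exact ⟨r, by omega⟩
  rw [cexp, Nat.mul_div_cancel' h2]
  omega

/-- `c_0 = 0`. [claim: Mochizuki2012, status: disputed] (IUTchII §1 Prop 1.5 (i), kurims p.29) -/
theorem cexp_zero : cexp 0 = 0 := rfl

/-- `c_1 = 1`. [claim: Mochizuki2012, status: disputed] (IUTchII §1 Prop 1.5 (i), kurims p.29) -/
theorem cexp_one : cexp 1 = 1 := rfl

/-- THE COCYCLE IDENTITY `c_{d+d'} = c_d + 3^d c_{d'}`. [claim: Mochizuki2012, status: disputed] (IUTchII §1 Prop 1.5 (i), kurims p.29) -/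
theorem cexp_add (d d' : ℕ) : (cexp (d + d') : ℤ) = cexp d + 3 ^ d * cexp d' := by
  have h := two_mul_cexp_add_one (d + d')
  have h1 := two_mul_cexp_add_one d
  have h2 := two_mul_cexp_add_one d'
  have key : 2 * (cexp (d + d') : ℤ) = 2 * (cexp d + 3 ^ d * cexp d') := by
    have e1 : (2 * cexp (d + d') + 1 : ℤ) = 3 ^ (d + d') := by exact_mod_cast h
    have e2 : (2 * cexp d + 1 : ℤ) = 3 ^ d := by exact_mod_cast h1
    have e3 : (2 * cexp d' + 1 : ℤ) = 3 ^ d' := by exact_mod_cast h2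
    have : (3 : ℤ) ^ (d + d') = 3 ^ d * 3 ^ d' := pow_add _ _ _
    nlinarith [e1, e2, e3, this]
  linarith

/-- The transition of the system with twist parameter `a ∈ ℤ` along `M ∣ M'`: `U^{a·c_d} ∘ red`. [claim: Mochizuki2012, status: disputed] (IUTchII §1 Prop 1.5 (i), kurims p.29) -/
def transOf (a : ℤ) {M M' : ℕ+} (h : (M : ℕ) ∣ (M' : ℕ)) : Car M' →* Car M :=
  Phom h (gap h) (a * cexp (gap h))

/-- Functoriality of `sys a` at identities. [claim: Mochizuki2012, status: disputed] (IUTchII §1 Prop 1.5, kurims p.29) -/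
theorem transOf_refl (a : ℤ) (M : ℕ+) (y : Car M) : transOf a (dvd_refl (M : ℕ)) y = y := by
  rw [transOf, Phom_apply, gap_refl, cexp_zero, Nat.cast_zero, mul_zero, Rhom_zero_zero, castMul_refl]
  rfl

/-- Functoriality of `sys a` at composites — the cocycle identity `c_{d+d'} = c_d + 3^d c_{d'}` at work. [claim: Mochizuki2012, status: disputed] (IUTchII §1 Prop 1.5, kurims p.29) -/
theorem transOf_comp (a : ℤ) {M M' M'' : ℕ+} (h : (M : ℕ) ∣ (M' : ℕ)) (h' : (M' : ℕ) ∣ (M'' : ℕ)) (y : Car M'') :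
    transOf a h (transOf a h' y) = transOf a (dvd_trans h h') y := by
  simp only [transOf, Phom_apply]
  refine Prod.ext (Prod.ext ?_ rfl) ?_
  · show ((Rhom _ _).comp (Rhom _ _)) y.1.1 = Rhom _ _ y.1.1
    rw [Rhom_comp, gap_trans h h', cexp_add]
    congr 2
    ring
  · show ((castMul h).comp (castMul h')) y.2 = castMul _ y.2
    rw [castMul_comp]


/-! ## Cones inside `Π_M` and their images under the structure maps -/

/-- `T̂_m ⊆ Π_M`: the elements whose `R`-coordinate lies in the cone of `m`. [claim: Mochizuki2012, status: disputed] (IUTchII §1 Prop 1.5 (i), kurims p.29) -/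
def coneHat (M : ℕ+) (m : Mon) : Subgroup (Car M) where
  carrier := {y | Multiplicative.toAdd y.1.1 ∈ cone m}
  mul_mem' := by
    intro y z hy hz
    exact (cone m).add_mem hy hz
  one_mem' := (cone m).zero_mem
  inv_mem' := by
    intro y hy
    exact (cone m).neg_mem hy

/-- Membership in `T̂_m`. [claim: Mochizuki2012, status: disputed] (IUTchII §1 Prop 1.5 (i), kurims p.29) -/
theorem mem_coneHat {M : ℕ+} {m : Mon} {y : Car M} : y ∈ coneHat M m ↔ Multiplicative.toAdd y.1.1 ∈ cone m :=
  Iff.rfl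

/-- `T̂_m ⊆ T̂_{m'} ↔ m' ≤ m`. [claim: Mochizuki2012, status: disputed] (IUTchII §1 Prop 1.5 (i), kurims p.29) -/
theorem coneHat_le_coneHat_iff {M : ℕ+} {m m' : Mon} : coneHat M m ≤ coneHat M m' ↔ m' ≤ m := by
  rw [← cone_le_cone_iff]
  constructor
  · intro h f hf
    have : (((Multiplicative.ofAdd f, 1), 1) : Car M) ∈ coneHat M m := hf
    exact h this
  · intro h y hy
    exact h hy

/-- Distinct monomials have distinct `T̂`'s. [claim: Mochizuki2012, status: disputed] (IUTchII §1 Prop 1.5 (i), kurims p.29) -/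
theorem coneHat_injective (M : ℕ+) : Function.Injective (coneHat M) := fun _ _ h =>
  le_antisymm (coneHat_le_coneHat_iff.mp h.symm.le) (coneHat_le_coneHat_iff.mp h.le)

/-- KEY COMPUTATION: `Phom h d k` carries `T̂_m ⊆ Π_{M'}` onto `T̂_{g_{d,k}(m)} ⊆ Π_M`. [claim: Mochizuki2012, status: disputed] (IUTchII §1 Prop 1.5 (i), kurims p.29) -/
theorem map_coneHat {M M' : ℕ+} (h : (M : ℕ) ∣ (M' : ℕ)) (d : ℕ) (k : ℤ) (m : Mon) :
    (coneHat M' m).map (Phom h d k) = coneHat M (gmap d k m) := by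
  ext x
  constructor
  · rintro ⟨y, hy, rfl⟩
    rw [mem_coneHat, Phom_apply]
    show Finsupp.mapDomain (gmap d k) (Multiplicative.toAdd y.1.1) ∈ cone (gmap d k m)
    rw [← map_cone_gmap d k m]
    exact AddSubgroup.mem_map_of_mem _ hy
  · intro hx
    rw [mem_coneHat, ← map_cone_gmap d k m] at hx
    obtain ⟨f, hf, hfx⟩ := hx
    obtain ⟨z, hz⟩ := castMul_surjective h x.2
    refine ⟨((Multiplicative.ofAdd f, x.1.2), z), hf, ?_⟩
    rw [Phom_apply]
    refine Prod.ext (Prod.ext ?_ rfl) hz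
    show Multiplicative.ofAdd (Finsupp.mapDomain (gmap d k) f) = x.1.1
    rw [show Finsupp.mapDomain (gmap d k) f = Multiplicative.toAdd x.1.1 from hfx]
    rfl

/-- The structure maps permute the family of cones `{T̂_m}` (index map `g_{d,k}` is onto). [claim: Mochizuki2012, status: disputed] (IUTchII §1 Prop 1.5 (i), kurims p.29) -/
theorem image_map_range_coneHat {M M' : ℕ+} (h : (M : ℕ) ∣ (M' : ℕ)) (d : ℕ) (k : ℤ) :
    (fun H : Subgroup (Car M') => H.map (Phom h d k)) '' Set.range (coneHat M') = Set.range (coneHat M) := by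
  ext H
  constructor
  · rintro ⟨_, ⟨m, rfl⟩, rfl⟩
    exact ⟨gmap d k m, (map_coneHat h d k m).symm⟩
  · rintro ⟨m, rfl⟩
    obtain ⟨m', rfl⟩ := gmap_surjective d k m
    exact ⟨coneHat M' m', ⟨m', rfl⟩, map_coneHat h d k m'⟩

end LimOneToy

end Literature.IUT.HodgeArakelov

end
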